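import Literature.AlgebraicGeometry.Motives.HodgeLieWeightOneIdealPairComponent
import HarnessLib

/-!
# Weight-one Hodge structures whose Hodge Lie algebra is a sum of two commuting three-dimensional ideals `𝔞 ⊕ 𝔟`.
# C: `π_𝔞 + π_𝔟 = 1`, `𝔟_ℂ π_𝔞 = 0`, rationality `π_𝔞 = p_ℂ`, and the structure theorem on `End_Hdg(V)`

Family `hodge`, layer `Literature/AlgebraicGeometry/Motives`; THEOREMS ONLY (no definition, no named fact; D-0026).
Third abstract file of the lane MT-RANK-SEVEN-SPLIT of the cell `pub-hodgecm2` (COR-CM), seat `b27` (setting as in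
`Motives/HodgeLieWeightOneIdealPair{,Component}`: polarizable weight-one `H`, polarization `ψ`, graded basis `e` with degrees
in `{0,1}`, `P = gradingEnd e deg`, `𝔥 = Lie Hg(H)`; ideals `𝔞, 𝔟 ≤ 𝔥` commuting elementwise with `𝔥 ≤ 𝔞 + 𝔟`,
`X ∈ 𝔞 ∖ End_Hdg(V)` with blocks `E₁, F₁`, `Y ∈ 𝔟 ∖ End_Hdg(V)` with blocks `E₂, F₂`, and the projectors
`π₁ = α⁻¹(E₁F₁ + F₁E₁)`, `π₂ = β⁻¹(E₂F₂ + F₂E₂)` of `Motives/HodgeLieWeightOneIdealPairComponent`).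

* §5 `exists_sq_ne_zero_of_ideal`, `exists_rat_idealProjector` — **`π₁ = p_ℂ` for a RATIONAL idempotent `p = q⁻¹X′²`,
  `X′ ∈ 𝔞`, `q ∈ ℚˣ`** (only `dim_ℚ 𝔞 = 3` is used): some `X′ ∈ 𝔞` has `X′² ≠ 0` — otherwise `AB + BA = 0` on `𝔞_ℂ`
  (bilinearity), in particular `E₁F₁ + F₁E₁ = απ₁ = 0` and `E₁ = E₁π₁ = 0`; then `X′_ℂ² = μπ₁`
  (`sq_eq_smul_idealProjector`), `μ ≠ 0`, and `X′⁴ = μX′²` makes `μ` rational (`exists_ratCast_eq_of_baseChange_eq_smul`);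
  `p` is a `ψ`-symmetric Hodge endomorphism commuting with `𝔥` and with `End_Hdg(V)`, `Dp = D = pD` on `𝔞`.
* §6 `idealPair_projector_add_eq_one` — **`π₁ + π₂ = 1`** when also `dim_ℚ 𝔟 = 3`: `R = (2P − 1)(1 − π₁ − π₂)` equals
  `B − β⁻¹[E₂,F₂] ∈ 𝔟_ℂ` and `A − α⁻¹[E₁,F₁] ∈ 𝔞_ℂ` (the two decompositions `2P − 1 = α⁻¹[E₁,F₁] + B = β⁻¹[E₂,F₂] + A` of
  `exists_ideal_component`), so `R ∈ 𝔞_ℂ` commutes with `E₁, F₁` (it lies in `𝔟_ℂ`), whence `R = 0`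
  (`eq_zero_of_mem_spanC_ideal_of_commute`) and `1 − π₁ − π₂ = (2P − 1)R = 0`; so `𝔟_ℂ π₁ = 0`: each ideal acts only on its
  own summand of `V_ℂ = range π₁ ⊕ range π₂` (the joint-weight analysis of an `𝔰𝔩₂ × 𝔰𝔩₂`-module whose Hodge operator
  `h₁ + h₂` has only the weights `±1`, done by projector calculus).
* §7 `exists_central_projector_of_ideal_pair` — the STRUCTURE THEOREM read on `End_ℚ(V)` (basis-free): for a polarizable
  effective weight-one `H` and commuting three-dimensional ideals `𝔞, 𝔟 ≤ Lie Hg(H)` with `Lie Hg(H) ≤ 𝔞 + 𝔟`, neither inside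
  `End_Hdg(V)`, a rational idempotent `p ∉ {0, 1}`, a `ψ`-symmetric Hodge endomorphism commuting with `End_Hdg(V)`, with
  `Xp = X = pX` on `𝔞`, `Yp = 0 = pY` on `𝔟`, `p = q⁻¹X′²` (`X′ ∈ 𝔞`), `1 − p = q′⁻¹Y′²` (`Y′ ∈ 𝔟`), `𝔞 ⊓ 𝔟 = ⊥`, the
  block form `pW ∈ 𝔞`, `W − pW ∈ 𝔟` of `W ∈ Lie Hg`, and both ideals are non-commutative.  Classically (Moonen–Zarhin 1999 §3 (3.1), Cor. (3.9) after Imai;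
  Hazama 1989): `Hg = Hg₁ × Hg₂` with `Hgᵢ` forms of `SL₂` acting on `V = pV ⊕ (1 − p)V` separately; for `H¹` of an
  abelian variety `p = e^*`, `e ∈ Z(End⁰ X)`, and `X ∼ B₁^{a+1} × B₂^{b+1}` (`CorCM/MumfordTateRankSevenSplit*`).

## References

* [MoonenZarhin1999LowDim] B. Moonen, Yu. Zarhin, *Hodge classes on abelian varieties of low dimension*, Math. Ann. 315
  (1999), §2, §3 (3.1), Thm. (3.2) and Cor. (3.9) (Imai: `Hg(E₁ × ⋯ × Eₙ) = ∏ Hg(Eᵢ)` for pairwise non-isogenous elliptic curves; arXiv v2 = Math. Ann. numbering — (3.7) is Ribet’s subtorus Lemma, earlier tree copies wrote «Cor. (3.7)» for (3.9)).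
* [Deligne1982HodgeCycles] P. Deligne, *Hodge cycles on abelian varieties*, LNM 900 (1982), I §3 (3.1–3.7).
* [FultonHarris1991] W. Fulton, J. Harris, *Representation Theory*, GTM 129 (1991), Lecture 11 (§11.1), §9.3.
* [Zarhin1983HodgeGroupsK3] Yu. G. Zarhin, *Hodge groups of K3 surfaces*, J. reine angew. Math. 341 (1983), §2.
-/

noncomputable section

open scoped TensorProduct

namespace Literature.AlgebraicGeometry.Motives

universe u

namespace HodgeStructure

open ProjectorBlocks Literature.RepresentationTheory.GeneralLinear

variable {V : Type u} [AddCommGroup V] [Module ℚ V] [Module.Finite ℚ V] [HodgeTensorFacts.{u, u}] {n : ℤ}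
  {S : Type u} [Fintype S] [DecidableEq S] {deg : S → ℤ}

/-! ## §5 Rationality of the projector `π = α⁻¹(EF + FE)` of a three-dimensional ideal -/

omit [Module.Finite ℚ V] [HodgeTensorFacts.{u, u}] in
/-- If every element of a rational subspace `𝔞 ⊆ End_ℚ(V)` squares to zero, then `AB + BA = 0` for all `A, B ∈ 𝔞_ℂ`
(polarisation `XY + YX = (X+Y)² − X² − Y²` and bilinearity). [folklore] -/
private theorem mul_add_mul_eq_zero_of_forall_sq_eq_zero {𝔞 : Submodule ℚ (Module.End ℚ V)} (h : ∀ X ∈ 𝔞, X * X = 0)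
    {A : Module.End ℂ (ℂ ⊗[ℚ] V)} (hA : A ∈ spanC 𝔞) {B : Module.End ℂ (ℂ ⊗[ℚ] V)} (hB : B ∈ spanC 𝔞) :
    A * B + B * A = 0 := by
  have hrat : ∀ X ∈ 𝔞, ∀ Y ∈ 𝔞, X * Y + Y * X = 0 := by
    intro X hX Y hY
    have hsq := h (X + Y) (𝔞.add_mem hX hY)
    rw [add_mul, mul_add, mul_add, h X hX, h Y hY, zero_add, add_zero] at hsq
    exact hsq
  unfold spanC at hA hB
  induction hA using Submodule.span_induction generalizing B with
  | mem A₀ hA₀ =>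
    obtain ⟨X, hX, rfl⟩ := hA₀
    induction hB using Submodule.span_induction with
    | mem B₀ hB₀ =>
      obtain ⟨Y, hY, rfl⟩ := hB₀
      rw [← LinearMap.baseChange_mul, ← LinearMap.baseChange_mul, ← LinearMap.baseChange_add, hrat X hX Y hY,
        LinearMap.baseChange_zero]
    | zero => rw [mul_zero, zero_mul, add_zero]
    | add x y _ _ hx hy =>
      have : X.baseChange ℂ * (x + y) + (x + y) * X.baseChange ℂ =
          (X.baseChange ℂ * x + x * X.baseChange ℂ) + (X.baseChange ℂ * y + y * X.baseChange ℂ) := by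
        rw [mul_add, add_mul]; abel
      rw [this, hx, hy, add_zero]
    | smul c x _ hx => rw [mul_smul_comm, smul_mul_assoc, ← smul_add, hx, smul_zero]
  | zero => rw [zero_mul, mul_zero, add_zero]
  | add x y _ _ hx hy =>
    have : (x + y) * B + B * (x + y) = (x * B + B * x) + (y * B + B * y) := by rw [add_mul, mul_add]; abel
    rw [this, hx hB, hy hB, add_zero]
  | smul c x _ hx => rw [smul_mul_assoc, mul_smul_comm, ← smul_add, hx hB, smul_zero]

/-- **Some element of a three-dimensional ideal `𝔞 ≤ 𝔥` (not inside `End_Hdg(V)`) has non-zero square** (weight `1`;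
`E F E = αE`, `F E F = αF`, `α ≠ 0` for the blocks of `X ∈ 𝔞 ∖ End_Hdg(V)`): otherwise `AB + BA = 0` on `𝔞_ℂ`
(`mul_add_mul_eq_zero_of_forall_sq_eq_zero`), in particular `EF + FE = απ = 0`, and `E = Eπ = 0`.
[cite: MoonenZarhin1999LowDim, §2] [cite: FultonHarris1991, Lecture 11 (§11.1)] -/
theorem exists_sq_ne_zero_of_ideal (H : HodgeStructure V n) (hn : n = 1)
    (e : Module.Basis S ℂ (ℂ ⊗[ℚ] V)) (hF : ∀ a, H.F a = Submodule.span ℂ (e '' {σ | a ≤ deg σ}))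
    (hFc : ∀ a, complexConj (H.F a) = Submodule.span ℂ (e '' {σ | deg σ ≤ n - a}))
    (hdeg : ∀ σ, deg σ = 0 ∨ deg σ = 1) {𝔞 : Submodule ℚ (Module.End ℚ V)}
    (hI : ∀ Z ∈ H.hodgeLie, ∀ X ∈ 𝔞, Z * X - X * Z ∈ 𝔞)
    {X : Module.End ℚ V} (hX : X ∈ 𝔞) (hXE : X ∉ H.endAlg) {α : ℂ} (hα : α ≠ 0)
    (hEFE : (gradingEnd e deg * X.baseChange ℂ * (1 - gradingEnd e deg)) *
        ((1 - gradingEnd e deg) * X.baseChange ℂ * gradingEnd e deg) *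
        (gradingEnd e deg * X.baseChange ℂ * (1 - gradingEnd e deg)) =
      α • (gradingEnd e deg * X.baseChange ℂ * (1 - gradingEnd e deg)))
    (hFEF : ((1 - gradingEnd e deg) * X.baseChange ℂ * gradingEnd e deg) *
        (gradingEnd e deg * X.baseChange ℂ * (1 - gradingEnd e deg)) *
        ((1 - gradingEnd e deg) * X.baseChange ℂ * gradingEnd e deg) =
      α • ((1 - gradingEnd e deg) * X.baseChange ℂ * gradingEnd e deg)) :
    ∃ X' ∈ 𝔞, X' * X' ≠ 0 := by
  classical
  subst hn
  by_contra hall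
  push Not at hall
  obtain ⟨hE0, -⟩ := projE_ne_zero_of_not_mem_endAlg H rfl e hF hFc hdeg hXE
  obtain ⟨hEd, hFd⟩ := projE_mem_spanC_of_ideal H rfl e hF hFc hdeg hI hX
  obtain ⟨-, -, -, hEQ', -, -, -, -, -, -, -⟩ := idealProjector_identities e hdeg X hα hEFE hFEF rfl
  have hzero := mul_add_mul_eq_zero_of_forall_sq_eq_zero hall hEd hFd
  apply hE0
  rw [← hEQ', hzero, smul_zero, mul_zero]

/-- **`π = α⁻¹(EF + FE)` is the complexification of a rational idempotent `p = q⁻¹X′²` with `X′ ∈ 𝔞`, `q ∈ ℚˣ`**; `p ≠ 0`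
is a Hodge endomorphism commuting with `𝔥` and with `End_Hdg(V)`, `ψ`-symmetric, and `D p = D = p D` for every `D ∈ 𝔞`
(three-dimensional ideal `𝔞 ≤ 𝔥`, `X ∈ 𝔞 ∖ End_Hdg(V)`, `E F E = αE`, `F E F = αF`, `α ≠ 0`).  PROOF: some `X′ ∈ 𝔞` has
`X′² ≠ 0` (`exists_sq_ne_zero_of_ideal`); `X′_ℂ² = μπ` (`sq_eq_smul_idealProjector`), `μ ≠ 0`, and `X′⁴ = μX′²` forces
`μ ∈ ℚ` (`exists_ratCast_eq_of_baseChange_eq_smul`); the identities of `π` descend (`eq_zero_of_baseChange_eq_zero`).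
This is `Motives/HodgeLieWeightOneSl2CenterSplitting.exists_rat_projector` with the trace-form argument replaced by
polarisation. [cite: MoonenZarhin1999LowDim, §2] [cite: Deligne1982HodgeCycles, I §3 (3.1–3.7)]
[cite: FultonHarris1991, Lecture 11 (§11.1)] -/
theorem exists_rat_idealProjector (H : HodgeStructure V n) (ψ : H.Polarization) (hn : n = 1)
    (e : Module.Basis S ℂ (ℂ ⊗[ℚ] V)) (hF : ∀ a, H.F a = Submodule.span ℂ (e '' {σ | a ≤ deg σ}))
    (hFc : ∀ a, complexConj (H.F a) = Submodule.span ℂ (e '' {σ | deg σ ≤ n - a}))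
    (hdeg : ∀ σ, deg σ = 0 ∨ deg σ = 1) {𝔞 : Submodule ℚ (Module.End ℚ V)} (h𝔞 : 𝔞 ≤ H.hodgeLie)
    (hI : ∀ Z ∈ H.hodgeLie, ∀ X ∈ 𝔞, Z * X - X * Z ∈ 𝔞) (h3 : Module.finrank ℚ 𝔞 = 3)
    {X : Module.End ℚ V} (hX : X ∈ 𝔞) (hXE : X ∉ H.endAlg) {α : ℂ} (hα : α ≠ 0)
    (hEFE : (gradingEnd e deg * X.baseChange ℂ * (1 - gradingEnd e deg)) *
        ((1 - gradingEnd e deg) * X.baseChange ℂ * gradingEnd e deg) *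
        (gradingEnd e deg * X.baseChange ℂ * (1 - gradingEnd e deg)) =
      α • (gradingEnd e deg * X.baseChange ℂ * (1 - gradingEnd e deg)))
    (hFEF : ((1 - gradingEnd e deg) * X.baseChange ℂ * gradingEnd e deg) *
        (gradingEnd e deg * X.baseChange ℂ * (1 - gradingEnd e deg)) *
        ((1 - gradingEnd e deg) * X.baseChange ℂ * gradingEnd e deg) =
      α • ((1 - gradingEnd e deg) * X.baseChange ℂ * gradingEnd e deg))
    {Q : Module.End ℂ (ℂ ⊗[ℚ] V)}
    (hQ : Q = α⁻¹ • ((gradingEnd e deg * X.baseChange ℂ * (1 - gradingEnd e deg)) *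
          ((1 - gradingEnd e deg) * X.baseChange ℂ * gradingEnd e deg) +
        ((1 - gradingEnd e deg) * X.baseChange ℂ * gradingEnd e deg) *
          (gradingEnd e deg * X.baseChange ℂ * (1 - gradingEnd e deg)))) :
    ∃ p : Module.End ℚ V, p.baseChange ℂ = Q ∧ p * p = p ∧ p ≠ 0 ∧
      (∃ X' ∈ 𝔞, ∃ q : ℚ, q ≠ 0 ∧ p = q⁻¹ • (X' * X')) ∧
      p ∈ H.endAlg ∧ (∀ W ∈ H.hodgeLie, W * p = p * W) ∧ (∀ a ∈ H.endAlg, a * p = p * a) ∧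
      (∀ D ∈ 𝔞, D * p = D ∧ p * D = D) ∧ (∀ v w, ψ.form (p v) w = ψ.form v (p w)) := by
  classical
  subst hn
  obtain ⟨hQQ, hPQ, -, hEQ', hQE, hFQ', hQF', -, -, -, -⟩ := idealProjector_identities e hdeg X hα hEFE hFEF hQ
  obtain ⟨hE0, -⟩ := projE_ne_zero_of_not_mem_endAlg H rfl e hF hFc hdeg hXE
  set P := gradingEnd e deg with hP
  set Y := X.baseChange ℂ with hY
  set E := P * Y * (1 - P) with hEdef
  set F := (1 - P) * Y * P with hFdef
  have hPP : P * P = P := gradingEnd_mul_gradingEnd_of_deg e hdeg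
  obtain ⟨B, hB𝔞, hBB0⟩ := exists_sq_ne_zero_of_ideal H rfl e hF hFc hdeg hI hX hXE hα hEFE hFEF
  have hBC : B.baseChange ℂ ∈ spanC 𝔞 := baseChange_mem_spanC hB𝔞
  obtain ⟨μ, hμ⟩ := sq_eq_smul_idealProjector H ψ rfl e hF hFc hdeg h𝔞 hI h3 hX hXE hα hEFE hFEF hQ hBC
  have hBBC : (B * B).baseChange ℂ = μ • Q := by rw [LinearMap.baseChange_mul, hμ]
  have hμ0 : μ ≠ 0 := by
    intro h0
    rw [h0, zero_smul] at hBBC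
    exact hBB0 (eq_zero_of_baseChange_eq_zero hBBC)
  have hB4 : (B * B * (B * B)).baseChange ℂ = μ • (B * B).baseChange ℂ := by
    rw [LinearMap.baseChange_mul, hBBC, smul_mul_smul_comm, hQQ, mul_smul]
  obtain ⟨q, hq⟩ := exists_ratCast_eq_of_baseChange_eq_smul hBB0 hB4
  have hq0 : q ≠ 0 := by
    rintro rfl
    exact hμ0 (by rw [← hq, Rat.cast_zero])
  set p : Module.End ℚ V := q⁻¹ • (B * B) with hpdef
  have hpQ : p.baseChange ℂ = Q := by
    rw [hpdef, baseChange_ratCast_smul, hBBC, smul_smul, Rat.cast_inv, hq, inv_mul_cancel₀ hμ0, one_smul]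
  have hpp : p * p = p := by
    have h : (p * p - p).baseChange ℂ = 0 := by rw [LinearMap.baseChange_sub, LinearMap.baseChange_mul, hpQ, hQQ, sub_self]
    exact sub_eq_zero.1 (eq_zero_of_baseChange_eq_zero h)
  have hp0 : p ≠ 0 := by
    intro h0
    apply hE0
    rw [← hEQ', ← hpQ, h0, LinearMap.baseChange_zero, mul_zero]
  -- `p` is a Hodge endomorphism commuting with `𝔥`
  have hpA : p ∈ H.endAlg := by
    have hc : p.baseChange ℂ * P = P * p.baseChange ℂ := by rw [hpQ, hPQ]
    exact mem_endAlg_of_projE_eq_zero H e hF hdeg (blocks_D hPP hc).1 (blocks_D hPP hc).2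
  have hpcomm : ∀ W ∈ H.hodgeLie, W * p = p * W := fun W hW => commute_of_mem_hodgeLie H hW ⟨p, hpA⟩
  have hpcA : ∀ a ∈ H.endAlg, a * p = p * a := by
    intro a ha
    have hBa : B * a = a * B := commute_of_mem_hodgeLie H (h𝔞 hB𝔞) ⟨a, ha⟩
    rw [hpdef, mul_smul_comm, smul_mul_assoc, ← mul_assoc, ← hBa, mul_assoc, ← hBa, ← mul_assoc]
  -- `D p = D = p D` on `𝔞`
  have hDp : ∀ D ∈ 𝔞, D * p = D ∧ p * D = D := by
    intro D hD
    obtain ⟨h1, h2⟩ := mul_idealProjector_of_mem_spanC H ψ rfl e hF hFc hdeg h𝔞 hI h3 hX hXE hα hEFE hFEF hQ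
      (baseChange_mem_spanC hD)
    constructor
    · apply sub_eq_zero.1
      apply eq_zero_of_baseChange_eq_zero
      rw [LinearMap.baseChange_sub, LinearMap.baseChange_mul, hpQ, h1, sub_self]
    · apply sub_eq_zero.1
      apply eq_zero_of_baseChange_eq_zero
      rw [LinearMap.baseChange_sub, LinearMap.baseChange_mul, hpQ, h2, sub_self]
  -- `ψ`-symmetry
  have hBskew : ∀ v w, ψ.form (B v) w + ψ.form v (B w) = 0 :=
    fun v w => form_apply_add_eq_zero_of_mem_hodgeLie ψ (h𝔞 hB𝔞) v w
  have hpsymm : ∀ v w, ψ.form (p v) w = ψ.form v (p w) := by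
    intro v w
    have h1 : ψ.form (B (B v)) w = ψ.form v (B (B w)) := by
      have ha := hBskew (B v) w
      have hb := hBskew v (B w)
      linarith
    simp only [hpdef, LinearMap.smul_apply, Module.End.mul_apply, map_smul, smul_eq_mul, h1]
  exact ⟨p, hpQ, hpp, hp0, ⟨B, hB𝔞, q, hq0, rfl⟩, hpA, hpcomm, hpcA, hDp, hpsymm⟩

/-! ## §6 The pair: `π₁ + π₂ = 1` and each ideal kills the other summand -/

/-- **`π₁ + π₂ = 1`** for a pair of commuting three-dimensional ideals `𝔞, 𝔟 ≤ 𝔥` with `𝔥 ≤ 𝔞 + 𝔟` (weight `1`, `ψ` a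
polarization; `X ∈ 𝔞 ∖ End_Hdg(V)` with `E₁F₁E₁ = αE₁`, `F₁E₁F₁ = αF₁`, `Y ∈ 𝔟 ∖ End_Hdg(V)` with `E₂F₂E₂ = βE₂`,
`F₂E₂F₂ = βF₂`, and the two decompositions `2P − 1 = α⁻¹[E₁,F₁] + B`, `B ∈ 𝔟_ℂ`, `2P − 1 = β⁻¹[E₂,F₂] + A`, `A ∈ 𝔞_ℂ` of
`exists_ideal_component`).  PROOF: `R = (2P − 1)(1 − π₁ − π₂) = B − β⁻¹[E₂,F₂] = A − α⁻¹[E₁,F₁]` lies in `𝔞_ℂ ∩ 𝔟_ℂ`, hence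
commutes with `E₁, F₁`, hence vanishes (`eq_zero_of_mem_spanC_ideal_of_commute`), and `(2P − 1)² = 1`.
[cite: MoonenZarhin1999LowDim, §3 (3.1) and Cor. (3.9)] [cite: Deligne1982HodgeCycles, I §3 (3.1–3.6)]
[cite: FultonHarris1991, Lecture 11 (§11.1)] -/
theorem idealPair_projector_add_eq_one (H : HodgeStructure V n) (ψ : H.Polarization) (hn : n = 1)
    (e : Module.Basis S ℂ (ℂ ⊗[ℚ] V)) (hF : ∀ a, H.F a = Submodule.span ℂ (e '' {σ | a ≤ deg σ}))
    (hFc : ∀ a, complexConj (H.F a) = Submodule.span ℂ (e '' {σ | deg σ ≤ n - a}))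
    (hdeg : ∀ σ, deg σ = 0 ∨ deg σ = 1) {𝔞 𝔟 : Submodule ℚ (Module.End ℚ V)} (h𝔞 : 𝔞 ≤ H.hodgeLie)
    (h𝔟 : 𝔟 ≤ H.hodgeLie) (hI𝔞 : ∀ Z ∈ H.hodgeLie, ∀ X ∈ 𝔞, Z * X - X * Z ∈ 𝔞)
    (hI𝔟 : ∀ Z ∈ H.hodgeLie, ∀ Y ∈ 𝔟, Z * Y - Y * Z ∈ 𝔟) (h3 : Module.finrank ℚ 𝔞 = 3)
    (hcomm : ∀ X ∈ 𝔞, ∀ Y ∈ 𝔟, X * Y = Y * X)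
    {X : Module.End ℚ V} (hX : X ∈ 𝔞) (hXE : X ∉ H.endAlg) {Y : Module.End ℚ V} (hY : Y ∈ 𝔟)
    {α β : ℂ} (hα : α ≠ 0) (hβ : β ≠ 0)
    (hEFE₁ : (gradingEnd e deg * X.baseChange ℂ * (1 - gradingEnd e deg)) *
        ((1 - gradingEnd e deg) * X.baseChange ℂ * gradingEnd e deg) *
        (gradingEnd e deg * X.baseChange ℂ * (1 - gradingEnd e deg)) =
      α • (gradingEnd e deg * X.baseChange ℂ * (1 - gradingEnd e deg)))
    (hFEF₁ : ((1 - gradingEnd e deg) * X.baseChange ℂ * gradingEnd e deg) *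
        (gradingEnd e deg * X.baseChange ℂ * (1 - gradingEnd e deg)) *
        ((1 - gradingEnd e deg) * X.baseChange ℂ * gradingEnd e deg) =
      α • ((1 - gradingEnd e deg) * X.baseChange ℂ * gradingEnd e deg))
    (hEFE₂ : (gradingEnd e deg * Y.baseChange ℂ * (1 - gradingEnd e deg)) *
        ((1 - gradingEnd e deg) * Y.baseChange ℂ * gradingEnd e deg) *
        (gradingEnd e deg * Y.baseChange ℂ * (1 - gradingEnd e deg)) =
      β • (gradingEnd e deg * Y.baseChange ℂ * (1 - gradingEnd e deg)))
    (hFEF₂ : ((1 - gradingEnd e deg) * Y.baseChange ℂ * gradingEnd e deg) *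
        (gradingEnd e deg * Y.baseChange ℂ * (1 - gradingEnd e deg)) *
        ((1 - gradingEnd e deg) * Y.baseChange ℂ * gradingEnd e deg) =
      β • ((1 - gradingEnd e deg) * Y.baseChange ℂ * gradingEnd e deg))
    {B : Module.End ℂ (ℂ ⊗[ℚ] V)} (hB : B ∈ spanC 𝔟)
    (hΘ𝔞 : (2 : ℂ) • gradingEnd e deg - 1 =
        α⁻¹ • ((gradingEnd e deg * X.baseChange ℂ * (1 - gradingEnd e deg)) *
            ((1 - gradingEnd e deg) * X.baseChange ℂ * gradingEnd e deg) -
          ((1 - gradingEnd e deg) * X.baseChange ℂ * gradingEnd e deg) *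
            (gradingEnd e deg * X.baseChange ℂ * (1 - gradingEnd e deg))) + B)
    {A : Module.End ℂ (ℂ ⊗[ℚ] V)} (hA : A ∈ spanC 𝔞)
    (hΘ𝔟 : (2 : ℂ) • gradingEnd e deg - 1 =
        β⁻¹ • ((gradingEnd e deg * Y.baseChange ℂ * (1 - gradingEnd e deg)) *
            ((1 - gradingEnd e deg) * Y.baseChange ℂ * gradingEnd e deg) -
          ((1 - gradingEnd e deg) * Y.baseChange ℂ * gradingEnd e deg) *
            (gradingEnd e deg * Y.baseChange ℂ * (1 - gradingEnd e deg))) + A)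
    {Q₁ : Module.End ℂ (ℂ ⊗[ℚ] V)}
    (hQ₁ : Q₁ = α⁻¹ • ((gradingEnd e deg * X.baseChange ℂ * (1 - gradingEnd e deg)) *
          ((1 - gradingEnd e deg) * X.baseChange ℂ * gradingEnd e deg) +
        ((1 - gradingEnd e deg) * X.baseChange ℂ * gradingEnd e deg) *
          (gradingEnd e deg * X.baseChange ℂ * (1 - gradingEnd e deg))))
    {Q₂ : Module.End ℂ (ℂ ⊗[ℚ] V)}
    (hQ₂ : Q₂ = β⁻¹ • ((gradingEnd e deg * Y.baseChange ℂ * (1 - gradingEnd e deg)) *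
          ((1 - gradingEnd e deg) * Y.baseChange ℂ * gradingEnd e deg) +
        ((1 - gradingEnd e deg) * Y.baseChange ℂ * gradingEnd e deg) *
          (gradingEnd e deg * Y.baseChange ℂ * (1 - gradingEnd e deg)))) :
    Q₁ + Q₂ = 1 := by
  classical
  subst hn
  obtain ⟨-, -, -, -, -, -, -, hΘQ₁, -, -, -⟩ := idealProjector_identities e hdeg X hα hEFE₁ hFEF₁ hQ₁
  obtain ⟨-, -, -, -, -, -, -, hΘQ₂, -, -, -⟩ := idealProjector_identities e hdeg Y hβ hEFE₂ hFEF₂ hQ₂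
  obtain ⟨hE₁d, hF₁d⟩ := projE_mem_spanC_of_ideal H rfl e hF hFc hdeg hI𝔞 hX
  obtain ⟨hE₂d, hF₂d⟩ := projE_mem_spanC_of_ideal H rfl e hF hFc hdeg hI𝔟 hY
  set P := gradingEnd e deg with hP
  set E₁ := P * X.baseChange ℂ * (1 - P) with hE₁def
  set F₁ := (1 - P) * X.baseChange ℂ * P with hF₁def
  set E₂ := P * Y.baseChange ℂ * (1 - P) with hE₂def
  set F₂ := (1 - P) * Y.baseChange ℂ * P with hF₂def
  have hPP : P * P = P := gradingEnd_mul_gradingEnd_of_deg e hdeg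
  have h𝔥C : ∀ {𝔠 : Submodule ℚ (Module.End ℚ V)}, 𝔠 ≤ H.hodgeLie → spanC 𝔠 ≤ spanC H.hodgeLie :=
    fun h => spanC_mono h
  have hBr₁ : E₁ * F₁ - F₁ * E₁ ∈ spanC 𝔞 := bracket_mem_spanC_of_ideal hI𝔞 (h𝔥C h𝔞 hE₁d) hF₁d
  have hBr₂ : E₂ * F₂ - F₂ * E₂ ∈ spanC 𝔟 := bracket_mem_spanC_of_ideal hI𝔟 (h𝔥C h𝔟 hE₂d) hF₂d
  -- `R = (2P − 1)(1 − Q₁ − Q₂)` lies in `𝔞_ℂ` and in `𝔟_ℂ`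
  set R := ((2 : ℂ) • P - 1) * (1 - Q₁ - Q₂) with hRdef
  have hR𝔟 : R = B - β⁻¹ • (E₂ * F₂ - F₂ * E₂) := by
    rw [hRdef, mul_sub, mul_sub, mul_one, hΘQ₁, hΘQ₂]
    nth_rewrite 1 [hΘ𝔞]
    abel
  have hR𝔞 : R = A - α⁻¹ • (E₁ * F₁ - F₁ * E₁) := by
    rw [hRdef, mul_sub, mul_sub, mul_one, hΘQ₁, hΘQ₂]
    nth_rewrite 1 [hΘ𝔟]
    abel
  have hRb : R ∈ spanC 𝔟 := by rw [hR𝔟]; exact (spanC 𝔟).sub_mem hB ((spanC 𝔟).smul_mem _ hBr₂)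
  have hRa : R ∈ spanC 𝔞 := by rw [hR𝔞]; exact (spanC 𝔞).sub_mem hA ((spanC 𝔞).smul_mem _ hBr₁)
  have hRE : R * E₁ = E₁ * R := (commute_of_mem_spanC_of_commute hcomm hE₁d hRb).symm
  have hRF : R * F₁ = F₁ * R := (commute_of_mem_spanC_of_commute hcomm hF₁d hRb).symm
  have hR0 : R = 0 :=
    eq_zero_of_mem_spanC_ideal_of_commute H ψ rfl e hF hFc hdeg h𝔞 hI𝔞 h3 hX hXE hα hEFE₁ hRa hRE hRF
  have h1 : 1 - Q₁ - Q₂ = 0 := by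
    have h := congrArg (fun T : Module.End ℂ (ℂ ⊗[ℚ] V) => ((2 : ℂ) • P - 1) * T) hR0
    simp only [hRdef, ← mul_assoc, theta_mul_theta hPP, one_mul, mul_zero] at h
    exact h
  rw [sub_sub, sub_eq_zero] at h1
  exact h1.symm

/-! ## §7 The structure theorem on `End_ℚ(V)` -/

/-- **Structure of a polarizable weight-one Hodge structure whose Hodge Lie algebra is a sum of two commuting
three-dimensional ideals, read on `End_ℚ(V)`** (basis-free).  For `𝔞, 𝔟 ≤ 𝔥 = Lie Hg(H)` ideals commuting elementwise,
`𝔥 ≤ 𝔞 + 𝔟`, `dim_ℚ 𝔞 = dim_ℚ 𝔟 = 3`, neither contained in `End_Hdg(V)`: there is a rational idempotent `p` with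
`p ≠ 0`, `p ≠ 1`, `p ∈ End_Hdg(V)` commuting with `End_Hdg(V)`, `ψ`-symmetric, `Xp = X = pX` for `X ∈ 𝔞`, `Yp = 0 = pY` for
`Y ∈ 𝔟`, `p = q⁻¹X′²` for some `X′ ∈ 𝔞` and `1 − p = q′⁻¹Y′²` for some `Y′ ∈ 𝔟` (`q, q′ ∈ ℚˣ`), `𝔞 ⊓ 𝔟 = ⊥`, and the Hodge
Lie algebra is block diagonal: `pW ∈ 𝔞` and `W − pW ∈ 𝔟` for `W ∈ 𝔥`.  Assembly of `exists_ideal_component` (both orders),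
`exists_rat_idealProjector` (both orders) and `idealPair_projector_add_eq_one` in a graded basis adapted to `H`
(`exists_basis_F_eq_span`).  Classically `Hg = Hg₁ × Hg₂`, `V = pV ⊕ (1 − p)V` (Moonen–Zarhin 1999 §3; Imai; Hazama).
[cite: MoonenZarhin1999LowDim, §3 (3.1), Thm. (3.2) and Cor. (3.9)] [cite: Deligne1982HodgeCycles, I §3 (3.1–3.7)]
[cite: Zarhin1983HodgeGroupsK3, §2] -/
theorem exists_central_projector_of_ideal_pair (H : HodgeStructure V n) (ψ : H.Polarization) (hn : n = 1)
    (heff : H.IsEffective) {𝔞 𝔟 : Submodule ℚ (Module.End ℚ V)} (h𝔞 : 𝔞 ≤ H.hodgeLie) (h𝔟 : 𝔟 ≤ H.hodgeLie)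
    (hI𝔞 : ∀ Z ∈ H.hodgeLie, ∀ X ∈ 𝔞, Z * X - X * Z ∈ 𝔞) (hI𝔟 : ∀ Z ∈ H.hodgeLie, ∀ Y ∈ 𝔟, Z * Y - Y * Z ∈ 𝔟)
    (hcomm : ∀ X ∈ 𝔞, ∀ Y ∈ 𝔟, X * Y = Y * X) (hsum : H.hodgeLie ≤ 𝔞 ⊔ 𝔟)
    (h3𝔞 : Module.finrank ℚ 𝔞 = 3) (h3𝔟 : Module.finrank ℚ 𝔟 = 3)
    (hne𝔞 : ¬ 𝔞 ≤ Subalgebra.toSubmodule H.endAlg) (hne𝔟 : ¬ 𝔟 ≤ Subalgebra.toSubmodule H.endAlg) :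
    ∃ p : Module.End ℚ V, p ∈ H.endAlg ∧ p * p = p ∧ p ≠ 0 ∧ p ≠ 1 ∧ (∀ a ∈ H.endAlg, a * p = p * a) ∧
      (∀ v w, ψ.form (p v) w = ψ.form v (p w)) ∧
      (∀ X ∈ 𝔞, X * p = X ∧ p * X = X) ∧ (∀ Y ∈ 𝔟, Y * p = 0 ∧ p * Y = 0) ∧
      (∃ X' ∈ 𝔞, ∃ q : ℚ, q ≠ 0 ∧ p = q⁻¹ • (X' * X')) ∧
      (∃ Y' ∈ 𝔟, ∃ q' : ℚ, q' ≠ 0 ∧ 1 - p = q'⁻¹ • (Y' * Y')) ∧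
      𝔞 ⊓ 𝔟 = ⊥ ∧ (∀ W ∈ H.hodgeLie, p * W ∈ 𝔞 ∧ W - p * W ∈ 𝔟) ∧
      (∃ X₁ ∈ 𝔞, ∃ X₂ ∈ 𝔞, X₁ * X₂ ≠ X₂ * X₁) ∧ (∃ Y₁ ∈ 𝔟, ∃ Y₂ ∈ 𝔟, Y₁ * Y₂ ≠ Y₂ * Y₁) := by
  classical
  obtain ⟨X, hX, hXE⟩ := SetLike.not_le_iff_exists.1 hne𝔞
  obtain ⟨Y, hY, hYE⟩ := SetLike.not_le_iff_exists.1 hne𝔟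
  rw [Subalgebra.mem_toSubmodule] at hXE hYE
  obtain ⟨S, deg, e, hF, hFc⟩ := exists_basis_F_eq_span H
  haveI : Fintype S := FiniteDimensional.fintypeBasisIndex e
  have hdeg : ∀ σ, deg σ = 0 ∨ deg σ = 1 := fun σ => by
    have h := heff.deg_mem_Icc_of_graded e hF hFc σ
    omega
  subst hn
  have hcomm' : ∀ Y ∈ 𝔟, ∀ X ∈ 𝔞, Y * X = X * Y := fun Y hY X hX => (hcomm X hX Y hY).symm
  have hsum' : H.hodgeLie ≤ 𝔟 ⊔ 𝔞 := by rwa [sup_comm]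
  obtain ⟨α, B, hα, hB, hEFE₁, hFEF₁, hΘ𝔞⟩ :=
    exists_ideal_component H ψ rfl e hF hFc hdeg h𝔞 hI𝔞 h3𝔞 hcomm hsum hX hXE
  obtain ⟨β, A, hβ, hA, hEFE₂, hFEF₂, hΘ𝔟⟩ :=
    exists_ideal_component H ψ rfl e hF hFc hdeg h𝔟 hI𝔟 h3𝔟 hcomm' hsum' hY hYE
  obtain ⟨p, hpQ, hpp, hp0, hpX', hpA, -, hpc, hDp, hpsymm⟩ :=
    exists_rat_idealProjector H ψ rfl e hF hFc hdeg h𝔞 hI𝔞 h3𝔞 hX hXE hα hEFE₁ hFEF₁ rfl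
  obtain ⟨p', hp'Q, -, hp'0, hp'Y', -, -, -, hDp', -⟩ :=
    exists_rat_idealProjector H ψ rfl e hF hFc hdeg h𝔟 hI𝔟 h3𝔟 hY hYE hβ hEFE₂ hFEF₂ rfl
  have hsum1 := idealPair_projector_add_eq_one H ψ rfl e hF hFc hdeg h𝔞 h𝔟 hI𝔞 hI𝔟 h3𝔞 hcomm hX hXE hY hα hβ hEFE₁
    hFEF₁ hEFE₂ hFEF₂ hB hΘ𝔞 hA hΘ𝔟 rfl rfl
  have hsumP : p + p' = 1 := by
    apply eq_of_sub_eq_zero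
    apply eq_zero_of_baseChange_eq_zero
    rw [LinearMap.baseChange_sub, LinearMap.baseChange_add, hpQ, hp'Q, hsum1]
    simp only [Module.End.one_eq_id, LinearMap.baseChange_id, sub_self]
  have hp'eq : p' = 1 - p := by rw [← hsumP, add_sub_cancel_left]
  have hp1 : p ≠ 1 := by
    intro h1
    apply hp'0
    rw [hp'eq, h1, sub_self]
  have hYp : ∀ Y ∈ 𝔟, Y * p = 0 ∧ p * Y = 0 := by
    intro Y' hY'
    obtain ⟨h1, h2⟩ := hDp' Y' hY'
    rw [hp'eq, mul_sub, mul_one, sub_eq_self] at h1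
    rw [hp'eq, sub_mul, one_mul, sub_eq_self] at h2
    exact ⟨h1, h2⟩
  have hinf : 𝔞 ⊓ 𝔟 = ⊥ := by
    rw [Submodule.eq_bot_iff]
    intro Z hZ
    obtain ⟨hZa, hZb⟩ := Submodule.mem_inf.1 hZ
    rw [← (hDp Z hZa).1, (hYp Z hZb).1]
  have hblk : ∀ W ∈ H.hodgeLie, p * W ∈ 𝔞 ∧ W - p * W ∈ 𝔟 := by
    intro W hW
    obtain ⟨a, ha, b, hb, rfl⟩ := Submodule.mem_sup.1 (hsum hW)
    have h : p * (a + b) = a := by rw [mul_add, (hDp a ha).2, (hYp b hb).2, add_zero]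
    rw [h, add_sub_cancel_left]
    exact ⟨ha, hb⟩
  refine ⟨p, hpA, hpp, hp0, hp1, hpc, hpsymm, hDp, hYp, hpX', ?_, hinf, hblk,
    exists_mul_ne_mul_of_ideal H ψ rfl heff h𝔞 hI𝔞 hX hXE, exists_mul_ne_mul_of_ideal H ψ rfl heff h𝔟 hI𝔟 hY hYE⟩
  obtain ⟨Y', hY', q', hq', hp'def⟩ := hp'Y'
  exact ⟨Y', hY', q', hq', by rw [← hp'eq, hp'def]⟩

end HodgeStructure

end Literature.AlgebraicGeometry.Motives

end
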